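import Summits.FinalStateConjecture.FinalStateConjecture.Theorems.ClusterCompletenessOmegaLimitMultiKerrSketchNoHairRefutation
import HarnessLib

/-!
# Crux `ClusterCompleteness.OmegaLimitMultiKerr` (stmt-FinalStateConjecture-17639), line `Sketch` v8 —
# the registered stub `stub_noHairUpToGauge` (v8 text) is FALSE AS TYPED

Wave-4 adversarial audit of the v8 no-hair stub (lead c3's skeleton `Lines/Sketch.lean` v8,
`def Sig.stub_noHairUpToGauge`). The v8 conclusion asks for a gauge `θ` on the new exterior
`Ext' = boostedKerrExterior Λ' c' M' a'` with, among other clauses,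

* the RATE clause `θ (x + s u) = θ x + (κ s) u` for all `x ∈ Ext'`, all real `s`, some `κ > 0`
  (`u = Λe₀ = Λ'e₀`), and
* the JET clause `∀ j R', ∃ C, ∀ x ∈ Ext', r'(x) ≤ R' → ‖iteratedFDeriv ℝ j θ x‖ ≤ C` — at EVERY order
  `j`, including `j = 0`, where `‖iteratedFDeriv ℝ 0 θ x‖ = ‖θ x‖`.

These two clauses are jointly unsatisfiable (`no_rate_gauge_with_bounded_zeroth_jet`): the truncated tube
`{x ∈ Ext' | r'(x) ≤ R'}` is invariant under `x ↦ x + s u` (the rest-frame radius `r' = r_{a'} ∘ Λ'⁻¹(· − c')`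
does not see the time coordinate, `Λ'⁻¹ u = e₀`), it is non-empty for `R'` large, and along such an orbit
`‖θ (x + s u)‖ ≥ κ s ‖u‖ − ‖θ x‖ → ∞`. Since the hypotheses of the stub are met by the exact Schwarzschild
form `G = g_{1,0}` on `{r > 2}` (`Λ = 1`, `c = 0`, `M = 1`, `a = 0`; smooth, Lorentzian, Ricci-flat,
`0`-close, tame at all orders by `exists_bound_iteratedFDeriv_kerr_bilin`, stationary, null inner boundary
`dr(G⁻¹dr) = 1 − 2/r`), the v8 text is false: **`stub_noHairUpToGauge_v8_false`**.

Diagnosis for the planners (two independent defects; the lead reshapes the skeleton, v9).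

1. (certified here) The `θ`-jet clause must start at order `1` (the rate clause makes `θ` unbounded on
   every truncated tube): replace `‖iteratedFDeriv ℝ j θ x‖` by `‖iteratedFDeriv ℝ (j + 1) θ x‖` (or guard
   `1 ≤ j →`). With that repair every honest input (`G` a boosted Kerr–Schild form, `θ` affine) passes.
2. (by hand; survives repair 1) The INNER-HORIZON MASQUERADE. Fix `0 < ν < 1` close to `1` and the
   closed labels `(M, a) = ((1 + ν²)/2, ν)` (so `r₊ = 1`, `r₋ = ν²`) and `(M₁, a₁) = ((1 + ν²)/(2ν), 1)`
   (so `r₊ = 1/ν`, `r₋ = ν`); let `B = diag(1, 1, 1, ν)` (squeeze `z`) and `G = B^* g_{M₁,1}`, i.e.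
   `G(x)(v, w) = g_{M₁,1}(Bx)(Bv, Bw)`, on `Ext = {r_ν > 1} × ℝ`. `B` maps the spheroid `{r_ν = 1}`
   (semi-axes `√(1+ν²), √(1+ν²), 1`) onto `{r_1 = ν}` (semi-axes `√(1+ν²), √(1+ν²), ν`) = the INNER horizon of
   `g_{M₁,1}`, and `Ext` onto `{r_1 > ν} × ℝ`. Then `G` is smooth, Lorentzian, Ricci-flat (`r_1 ∘ B ≥ ν > 0`,
   `ricAt_pullMetric` + `ricAt_kerr_bilin`), `e₀`-stationary (`Be₀ = e₀`), tame at all orders on every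
   `{r ≤ R'}`, `O(1 − ν)`-close to `g_{M,ν}` uniformly on `Ext` (both are `O(1/r)`-close to `η`, resp. `BᵀηB`,
   far out; near the hole by uniform continuity in `(ν, x⃗)` at `ν = 1`, where the two forms coincide), and its
   inner boundary is null: `dr_ν(G⁻¹dr_ν)(x) = g_{M₁,1}⁻¹(β, β)(Bx)` with `β = dr_ν ∘ B⁻¹` conormal to
   `B{r_ν = 1} = {r_1 = ν}`, where `g^{rr} = Δ₁/Σ₁ = 0` (`Δ₁(ν) = ν² − (1+ν²) + 1 = 0`), so it tends to `0`
   uniformly at the boundary by compactness of the `t = 0` slice. Yet NO `(M', a', Λ', c', θ, κ)` as in the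
   conclusion exists (only differentiability of `θ`, the rate clause, `θ '' Ext' = Ext` and the isometry clause
   are used): the isometry clause at `(e₀, e₀)` reads `κ² (−1 + 2H₁(Bθx)) = −1 + 2H'(x)`; far out in `Ext'`
   (`H' → 0`, `H₁ ≥ 0`) it gives `κ² ≥ 1`, far out in `Ext` (`H₁ → 0`, `H' ≥ 0`, ontoness) `κ² ≤ 1`; so
   `H₁(By) = H'(θ⁻¹y) < M'/r₊' ≤ 1` for every `y ∈ Ext`, whereas at the equatorial point
   `y* = (0, √(r*² + 1), 0, 0)`, `ν < r* < M₁` (`By* = y*`, `r_1(y*) = r*`, `r_ν(y*) = √(r*² + 1 − ν²) > 1`)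
   one has `H₁(y*) = M₁/r* > 1`. Geometrically: `(Ext, G)` contains the Killing horizon `B⁻¹{r_1 = 1/ν}` in
   its interior (the Killing orbits are spacelike on `B⁻¹{ν < r_1 < 1/ν}`), so it is isometric to no Kerr
   EXTERIOR. The hypotheses lack "`Ext` lies outside every horizon of `G`", e.g. `0 < dr(G⁻¹dr)` on `Ext`
   (true for the honest inputs, where it is `Δ/Σ > 0`), or the non-degenerate red-shift as a HYPOTHESIS.
-/

set_option linter.dupNamespace false
set_option maxSynthPendingDepth 3

noncomputable section

open scoped Topology Manifold ContDiff
open Filter Set Function TopologicalSpace Literature.Geometry.Lorentzian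
open Summit.FinalStateConjecture.FinalStateConjecture.Theorems.SublinearIsFree.Rechart
  (exists_bound_iteratedFDeriv_ksPert)
open Summit.FinalStateConjecture.FinalStateConjecture.Theorems.SublinearIsFree.Slaving
  (ricAt_kerr_bilin)

namespace Summit.FinalStateConjecture.FinalStateConjecture.Theorems.ClusterCompleteness

/-! ### All-order tame bounds of the Kerr–Schild form away from the ring -/

/-- **Uniform bounds for all derivatives of `g_{M,a}` on `{r ≥ r₀}`**, `r₀ > 0`, every order `j`:
`g_{M,a} = η + (g_{M,a} − η)` with `η` constant and `exists_bound_iteratedFDeriv_ksPert`. [folklore] -/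
theorem exists_bound_iteratedFDeriv_kerr_bilin (M a : ℝ) {r₀ : ℝ} (hr₀ : 0 < r₀) (j : ℕ) :
    ∃ C : ℝ, ∀ x : E4, r₀ ≤ Kerr.radius a x → ‖iteratedFDeriv ℝ j (Kerr.bilin M a) x‖ ≤ C := by
  obtain ⟨C, hC⟩ := exists_bound_iteratedFDeriv_ksPert M a hr₀ j
  refine ⟨‖(Minkowski.bilin : E4 →L[ℝ] E4 →L[ℝ] ℝ)‖ + |C|, fun x hx ↦ ?_⟩
  have hr : 0 < Kerr.radius a x := hr₀.trans_le hx
  have hsplit : Kerr.bilin M a = (fun _ : E4 ↦ (Minkowski.bilin : E4 →L[ℝ] E4 →L[ℝ] ℝ)) +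
      fun y ↦ Kerr.bilin M a y - Minkowski.bilin := by
    funext y
    exact (add_sub_cancel Minkowski.bilin (Kerr.bilin M a y)).symm
  have hks : ContDiffAt ℝ j (fun y ↦ Kerr.bilin M a y - Minkowski.bilin) x :=
    Kerr.contDiffAt_ksPert (M := M) hr
  rw [hsplit, iteratedFDeriv_add_apply contDiffAt_const hks]
  refine (norm_add_le _ _).trans (add_le_add ?_ ((hC x hx).trans (le_abs_self C)))
  rcases Nat.eq_zero_or_pos j with rfl | hj
  · rw [norm_iteratedFDeriv_zero]
  · rw [iteratedFDeriv_const_of_ne (𝕜 := ℝ) (E := E4) (by omega : j ≠ 0)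
      (Minkowski.bilin : E4 →L[ℝ] E4 →L[ℝ] ℝ), Pi.zero_apply, norm_zero]
    exact norm_nonneg _

/-! ### The rate clause forbids a bounded zeroth jet -/

/-- **No rate-`κ` gauge has a bounded zeroth jet on a truncated tube.** If `θ (x + s u) = θ x + (κ s) u`
on `Ext' = boostedKerrExterior Λ' c' M' a'` with `κ > 0`, `u ≠ 0`, `Λ'e₀ = u`, `0 < M'`, then the order-`0`
bounds `‖iteratedFDeriv ℝ 0 θ x‖ = ‖θ x‖ ≤ C(R')` on `{x ∈ Ext' | r'(x) ≤ R'}` fail: this tube is invariant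
under `x ↦ x + s u` and non-empty for `R'` large, and `‖θ (x + s u)‖ ≥ κ s ‖u‖ − ‖θ x‖`. [folklore] -/
theorem no_rate_gauge_with_bounded_zeroth_jet {M' a' κ : ℝ} {Λ' : lorentzGroup} {c' u : E4}
    {θ : E4 → E4} (hM' : 0 < M') (hκ : 0 < κ) (hu : u ≠ 0)
    (hΛ' : (Λ' : E4 ≃L[ℝ] E4) (E4.basisVector 0) = u)
    (hcomm : ∀ x ∈ (boostedKerrExterior Λ' c' M' a' : Set E4), ∀ s : ℝ,
      θ (x + s • u) = θ x + (κ * s) • u)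
    (htame : ∀ R' : ℝ, ∃ C : ℝ, ∀ x ∈ (boostedKerrExterior Λ' c' M' a' : Set E4),
      Kerr.radius a' (poincareInv Λ' c' x) ≤ R' → ‖iteratedFDeriv ℝ 0 θ x‖ ≤ C) : False := by
  have hΛ's : (Λ' : E4 ≃L[ℝ] E4).symm u = E4.basisVector 0 := by
    rw [ContinuousLinearEquiv.symm_apply_eq]
    exact hΛ'.symm
  -- a point `x₀` of the new exterior, rest-frame position `y₀`
  obtain ⟨K, hK⟩ : ∃ K : ℝ, K = 2 * M' + 1 := ⟨_, rfl⟩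
  have hK0 : 0 < K := by rw [hK]; linarith
  obtain ⟨R, hR⟩ : ∃ R : ℝ, R = K + |a'| + 1 := ⟨_, rfl⟩
  have hRpos : 0 < R := by rw [hR]; positivity
  obtain ⟨y₀, hy₀⟩ : ∃ y₀ : E4, y₀ = E4.ofTimeSpace 0 (R • EuclideanSpace.single (0 : Fin 3) (1 : ℝ)) :=
    ⟨_, rfl⟩
  have hy₀n : E4.spatialNorm y₀ = R := by
    rw [hy₀, E4.spatialNorm_ofTimeSpace, norm_smul, PiLp.norm_single, norm_one, mul_one,
      Real.norm_eq_abs, abs_of_pos hRpos]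
  have hrad : K < Kerr.radius a' y₀ := by
    have h1 := Kerr.spatialNorm_sq_sub_sq_le_radius_sq a' y₀
    rw [hy₀n] at h1
    have h2 : K ^ 2 < R ^ 2 - a' ^ 2 := by
      rw [hR]
      nlinarith [abs_nonneg a', sq_abs a']
    nlinarith [Kerr.radius_nonneg a' y₀]
  have hrpos : 0 < Kerr.radius a' y₀ := hK0.trans hrad
  obtain ⟨x₀, hx₀⟩ : ∃ x₀ : E4, x₀ = (Λ' : E4 ≃L[ℝ] E4) y₀ + c' := ⟨_, rfl⟩
  have hpx : ∀ s : ℝ, poincareInv Λ' c' (x₀ + s • u) = y₀ + s • E4.basisVector 0 := by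
    intro s
    rw [poincareInv, hx₀, show (Λ' : E4 ≃L[ℝ] E4) y₀ + c' + s • u - c' =
      (Λ' : E4 ≃L[ℝ] E4) y₀ + s • u by abel, map_add, map_smul,
      ContinuousLinearEquiv.symm_apply_apply, hΛ's]
  have hrad_s : ∀ s : ℝ, Kerr.radius a' (poincareInv Λ' c' (x₀ + s • u)) = Kerr.radius a' y₀ := by
    intro s
    rw [hpx s]
    refine Kerr.radius_eq_of_spatial_eq a' ?_
    rw [map_add, map_smul, E4.spatial_basisVector_zero, smul_zero, add_zero]
  have hmem : ∀ s : ℝ, x₀ + s • u ∈ (boostedKerrExterior Λ' c' M' a' : Set E4) := by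
    intro s
    rw [SetLike.mem_coe, mem_boostedKerrExterior, Kerr.mem_exterior, hrad_s s]
    refine max_lt ?_ hrpos
    have hrp : Kerr.rPlus M' a' ≤ 2 * M' := by
      unfold Kerr.rPlus
      have h1 : √(M' ^ 2 - a' ^ 2) ≤ √(M' ^ 2) := Real.sqrt_le_sqrt (by nlinarith [sq_nonneg a'])
      rw [Real.sqrt_sq hM'.le] at h1
      linarith
    calc Kerr.rPlus M' a' ≤ 2 * M' := hrp
      _ < K := by rw [hK]; linarith
      _ < Kerr.radius a' y₀ := hrad
  have hx₀mem : x₀ ∈ (boostedKerrExterior Λ' c' M' a' : Set E4) := by simpa using hmem 0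
  -- the order-0 bound on the tube `{r' ≤ r'(x₀)}` and a far point of the orbit of `x₀`
  obtain ⟨C, hC⟩ := htame (Kerr.radius a' y₀)
  have hupos : 0 < ‖u‖ := norm_pos_iff.2 hu
  set s : ℝ := (|C| + ‖θ x₀‖ + 1) / (κ * ‖u‖) with hs
  have hs0 : 0 < s := by rw [hs]; positivity
  have hks : ‖(κ * s) • u‖ = |C| + ‖θ x₀‖ + 1 := by
    rw [norm_smul, Real.norm_eq_abs, abs_of_pos (mul_pos hκ hs0), hs]
    field_simp
  have hbd := hC (x₀ + s • u) (hmem s) (hrad_s s).le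
  rw [norm_iteratedFDeriv_zero, hcomm x₀ hx₀mem s] at hbd
  have hrev : ‖(κ * s) • u‖ ≤ ‖θ x₀ + (κ * s) • u‖ + ‖θ x₀‖ := by
    calc ‖(κ * s) • u‖ = ‖(θ x₀ + (κ * s) • u) - θ x₀‖ := by rw [add_sub_cancel_left]
      _ ≤ ‖θ x₀ + (κ * s) • u‖ + ‖θ x₀‖ := norm_sub_le _ _
  rw [hks] at hrev
  linarith [le_abs_self C]

/-! ### The refutation -/

/-- **`stub_noHairUpToGauge` (v8 text) is false as typed.** The exact Schwarzschild form `G = g_{1,0}` on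
`{r > 2}` (`k = 0`, `Λ = 1`, `c = 0`, `M = 1`, `a = 0`) meets every hypothesis — smooth, Lorentzian,
Ricci-flat, `0`-close to itself, tame at all orders (`exists_bound_iteratedFDeriv_kerr_bilin`), stationary,
null inner boundary `dr(G⁻¹dr) = 1 − 2/r` — but the conclusion is unsatisfiable for EVERY input: its rate
clause `θ(x + s e₀) = θ(x) + κ s e₀`, `κ > 0`, contradicts its order-`0` jet bound
`‖iteratedFDeriv ℝ 0 θ x‖ = ‖θ x‖ ≤ C` on the (translation-invariant, non-empty) truncated tubes of the new
exterior (`no_rate_gauge_with_bounded_zeroth_jet`). See the module docstring for the second, deeper defect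
(the inner-horizon masquerade) that survives the obvious repair `j ↦ j + 1`. [folklore] -/
theorem stub_noHairUpToGauge_v8_false : ¬ (∀ k : ℕ, ∀ (Λ : lorentzGroup) (c : E4) (M a : ℝ), 0 < M → |a| ≤ M → ∀ (G : E4 → E4 →L[ℝ] E4 →L[ℝ] ℝ), ContDiffOn ℝ ∞ G (boostedKerrExterior Λ c M a : Set E4) → (∀ x ∈ (boostedKerrExterior Λ c M a : Set E4), (G x).IsInvertible ∧ (∀ v w : E4, G x v w = G x w v) ∧ ∃ v : E4, G x v v < 0 ∧ ∀ w : E4, G x v w = 0 → w ≠ 0 → 0 < G x w w) → (∀ x ∈ (boostedKerrExterior Λ c M a : Set E4), MetricCoord.ricAt G x = 0) → (∀ x ∈ (boostedKerrExterior Λ c M a : Set E4), ‖G x - boostedKerrBilin Λ c M a x‖ ≤ 1 / 32) → (∀ (j : ℕ) (R' : ℝ), ∃ C : ℝ, ∀ x ∈ (boostedKerrExterior Λ c M a : Set E4), Kerr.radius a (poincareInv Λ c x) ≤ R' → ‖iteratedFDeriv ℝ j G x‖ ≤ C) → (∀ x ∈ (boostedKerrExterior Λ c M a : Set E4), ∀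 s : ℝ, G (x + s • ((Λ : E4 ≃L[ℝ] E4) (E4.basisVector 0))) = G x) → (∀ ε : ℝ, 0 < ε → ∃ δ : ℝ, 0 < δ ∧ ∀ x ∈ (boostedKerrExterior Λ c M a : Set E4), Kerr.radius a (poincareInv Λ c x) < Kerr.rPlus M a + δ → |((fderiv ℝ (fun y ↦ Kerr.radius a (poincareInv Λ c y)) x) (MetricCoord.sharpAt G x (fderiv ℝ (fun y ↦ Kerr.radius a (poincareInv Λ c y)) x)))| ≤ ε) → ∃ (M' a' : ℝ) (Λ' : lorentzGroup) (c' : E4) (θ : E4 → E4) (κ : ℝ), 0 < M' ∧ |a'| ≤ M' ∧ 0 < κ ∧ (Λ' : E4 ≃L[ℝ] E4) (E4.basisVector 0) = ((Λ : E4 ≃L[ℝ] E4) (E4.basisVector 0)) ∧ ContDiffOn ℝ ∞ θ (boostedKerrExterior Λ' c' M' a' : Set E4) ∧ Set.InjOn θ (boostedKerrExterior Λ' c' M' a' : Set E4) ∧ θ '' (boostedKerrExterior Λ' c' M' a' : Set E4) = (boostedKerrExterior Λ c M a : Set E4) ∧ (∀ x ∈ (boostedKerrExterior Λ' c' M' a'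 : Set E4), ∀ s : ℝ, θ (x + s • ((Λ : E4 ≃L[ℝ] E4) (E4.basisVector 0))) = θ x + (κ * s) • ((Λ : E4 ≃L[ℝ] E4) (E4.basisVector 0))) ∧ (∀ x ∈ (boostedKerrExterior Λ' c' M' a' : Set E4), ‖fderiv ℝ θ x‖ ≤ 2) ∧ (∀ (j : ℕ) (R' : ℝ), ∃ C : ℝ, ∀ x ∈ (boostedKerrExterior Λ' c' M' a' : Set E4), Kerr.radius a' (poincareInv Λ' c' x) ≤ R' → ‖iteratedFDeriv ℝ j θ x‖ ≤ C) ∧ ∀ x ∈ (boostedKerrExterior Λ' c' M' a' : Set E4), ∀ v w : E4, G (θ x) (fderiv ℝ θ x v) (fderiv ℝ θ x w) = boostedKerrBilin Λ' c' M' a' x v w ∧ ((∃ κ₀ δ : ℝ, 0 < κ₀ ∧ 0 < δ ∧ ∀ x ∈ (boostedKerrExterior Λ c M a : Set E4), Kerr.radius a (poincareInv Λ c x) < Kerr.rPlus M a + δ → κ₀ * (Kerr.radius a (poincareInv Λ c x) - Kerr.rPlus M a) ≤ (fderiv ℝ (fun y ↦ Kerr.radius a (poincareInv Λ c y)) x)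 (MetricCoord.sharpAt G x (fderiv ℝ (fun y ↦ Kerr.radius a (poincareInv Λ c y)) x))) → Kerr.IsSubextremal M' a')) := by
  intro h
  -- the exact Schwarzschild form, read as the time dilation with unit factor `A = B = id`
  set A : E4 →L[ℝ] E4 := ContinuousLinearMap.id ℝ E4 with hA_def
  have hA : ∀ w : E4, A w = w + (((1 : ℝ) - 1) * w 0) • E4.basisVector 0 := fun w ↦ by
    rw [sub_self, zero_mul, zero_smul, add_zero, hA_def, ContinuousLinearMap.id_apply]
  have hB : ∀ w : E4, A w = w + (((1 : ℝ)⁻¹ - 1) * w 0) • E4.basisVector 0 := fun w ↦ by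
    rw [inv_one, sub_self, zero_mul, zero_smul, add_zero, hA_def, ContinuousLinearMap.id_apply]
  have hG : ∀ y v w, Kerr.bilin 1 0 y v w = Kerr.bilin 1 0 y (A v) (A w) := fun y v w ↦ by
    rw [hA_def, ContinuousLinearMap.id_apply, ContinuousLinearMap.id_apply]
  -- the exterior `{r > 2}` and the unit time axis
  have h1e : ((1 : lorentzGroup) : E4 ≃L[ℝ] E4) (E4.basisVector 0) = E4.basisVector 0 := rfl
  have hExt : ∀ x : E4, x ∈ (boostedKerrExterior 1 0 1 0 : Set E4) ↔ 2 < Kerr.radius 0 x := by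
    intro x
    rw [SetLike.mem_coe, mem_boostedKerrExterior, poincareInv_one_zero, Kerr.mem_exterior,
      Kerr.rPlus_zero_right zero_le_one, mul_one, max_eq_left zero_le_two]
  have hfun : (fun y ↦ Kerr.radius 0 (poincareInv 1 0 y)) = Kerr.radius 0 :=
    funext fun y ↦ by rw [poincareInv_one_zero]
  have hmain := h 0 1 0 1 0 one_pos (by norm_num) (Kerr.bilin 1 0)
  refine absurd (hmain ?_ ?_ ?_ ?_ ?_ ?_ ?_) ?_
  · -- H1: smoothness
    intro x hx
    have hr : 0 < Kerr.radius 0 x := by linarith [(hExt x).1 hx]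
    exact (Kerr.contDiffAt_bilin 1 0 hr).contDiffWithinAt
  · -- H2: Lorentzian, symmetric, invertible
    intro x hx
    have hr : 0 < Kerr.radius 0 x := by linarith [(hExt x).1 hx]
    exact ⟨isInvertible_dilated hA hB hG one_ne_zero hr, fun v w ↦ Kerr.bilin_symm 1 0 x v w,
      dilated_signature hA hB hG one_ne_zero hr⟩
  · -- H3: Ricci-flat
    intro x hx
    have hr : 0 < Kerr.radius 0 x := by linarith [(hExt x).1 hx]
    ext Y Z
    rw [ricAt_kerr_bilin 1 0 hr]
    rfl
  · -- H4: `C⁰` anchor (the form is its own reference)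
    intro x _
    rw [boostedKerrBilin_one_zero, sub_self, norm_zero]
    norm_num
  · -- H5: tame bounds, every order, every `R'`
    intro j R'
    obtain ⟨C, hC⟩ := exists_bound_iteratedFDeriv_kerr_bilin 1 0 two_pos j
    exact ⟨C, fun x hx _ ↦ hC x ((hExt x).1 hx).le⟩
  · -- H6: stationarity
    intro x _ t
    rw [h1e, Kerr.bilin_add_smul_basisVector_zero]
  · -- H7: null inner boundary
    intro ε hε
    refine ⟨ε, hε, fun x hx hlt ↦ ?_⟩
    rw [poincareInv_one_zero, Kerr.rPlus_zero_right zero_le_one] at hlt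
    have hr2 : 2 < Kerr.radius 0 x := (hExt x).1 hx
    have hr : 0 < Kerr.radius 0 x := by linarith
    rw [hfun, fderiv_radius_sharpAt_dilated hA hB hG one_ne_zero hr]
    have heq : 1 - 2 / Kerr.radius 0 x = (Kerr.radius 0 x - 2) / Kerr.radius 0 x := by
      field_simp
    rw [heq, abs_of_nonneg (div_nonneg (by linarith) hr.le), div_le_iff₀ hr]
    nlinarith
  · -- the conclusion fails: rate clause versus order-0 jet bound
    clear hmain
    rintro ⟨M', a', Λ', c', θ, κ, hM', -, hκ, hΛ', -, -, -, hcomm, -, htame, -⟩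
    clear h
    rw [h1e] at hΛ' hcomm
    have he₀ : (E4.basisVector 0 : E4) ≠ 0 := by
      intro h0
      have : ‖(E4.basisVector 0 : E4)‖ = 0 := by rw [h0, norm_zero]
      rw [PiLp.norm_single, norm_one] at this
      exact one_ne_zero this
    exact no_rate_gauge_with_bounded_zeroth_jet hM' hκ he₀ hΛ' hcomm fun R' ↦ htame 0 R'

end Summit.FinalStateConjecture.FinalStateConjecture.Theorems.ClusterCompleteness

end
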